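import Mathlib
import Summits.Ventures.PercRepro2.LocRows
import Summits.Ventures.PercRepro2.SwRow
import Summits.Ventures.PercRepro2.SwOut
import Summits.Ventures.PercRepro2.SwAllRow
import Summits.Ventures.PercRepro2.SwOutAll
import Summits.Ventures.PercRepro2.SwOutArmFlip
import Summits.Ventures.PercRepro2.SwOutArms
import Summits.Ventures.PercRepro2.SwOutArmOrbit
import Summits.Ventures.PercRepro2.SwOutArmCube
import Summits.Ventures.PercRepro2.SwOutArmThm
import Summits.Ventures.PercRepro2.SwOutCoreDefs
import Summits.Ventures.PercRepro2.SwOutCoreHull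
import Summits.Ventures.PercRepro2.SwOutCoreDual
import Summits.Ventures.PercRepro2.SwOutCoreCube
import Summits.Ventures.PercRepro2.SwOutCoreKey
import Summits.Ventures.PercRepro2.SwOutShadowDefs
import Summits.Ventures.PercRepro2.SwOutShadowCube
import Summits.Ventures.PercRepro2.SwOutShadowIneq
import Summits.Ventures.PercRepro2.SwOutCoreShadowDefs
import Summits.Ventures.PercRepro2.SwOutCoreShadow
import Summits.Ventures.PercRepro2.SwOutCoreShadowFlip
import Summits.Ventures.PercRepro2.SwOutCoreShadowEsc
import Summits.Ventures.PercRepro2.SwOutJunction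
import Summits.Ventures.PercRepro2.SwOutJunctionRegion
import Summits.Ventures.PercRepro2.SwOutJunctionH1Defs
import Summits.Ventures.PercRepro2.SwOutJunctionH1Arms
import Summits.Ventures.PercRepro2.SwOutJunctionH1Cover
import Summits.Ventures.PercRepro2.SwOutJunctionH1Inside
import Summits.Ventures.PercRepro2.SwOutJunctionH1Base
import Summits.Ventures.PercRepro2.SwOutCoreToggle
import Summits.Ventures.PercRepro2.SwOutCoreShadowArm
import Summits.Ventures.PercRepro2.SwOutCoreShadowKey
import Summits.Ventures.PercRepro2.SwOutCoreShadowKind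
import Summits.Ventures.PercRepro2.SwOutCoreShadowUnion
import Summits.Ventures.PercRepro2.SwOutCoreShadowOrbit

/-!
# The kinds of the (H1) single junction: the orbits through a sealed point or a shadow point
(blind cell PercRepro2, night-4 g14, 2026-08-26; proofs/NIGHT4-G14.md §5)

A `Q`-point of a single-junction class is OUT (`u` outside the hull of `h`), of the CORE KIND
(`u` in the hull, the hull of `u` inside `U`), of the SHADOW KIND (`SwOutCoreShadowKind`), or
ESCAPING OF THE PLAIN KIND (escaping and not of the shadow kind).  An escaping point is core-free
(`coreFree_of_escaping`); a core-free core-kind point is one-sided (`oneSided_of_coreFree`) and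
has a normalised one-sided point (`exists_normalised`).  THE TWO ORBIT LEMMAS: an escaping
`Q`-point lying in the coarse orbit of a core-free core-kind point
(`shadowKind_of_mem_orbit_coreKind`), or of a shadow-kind point
(`shadowKind_of_mem_orbit_shadowKind`), is of the shadow kind — the orbit passes through the core
cube and the shadow cubes of the normalised point (`SwOutCoreShadowOrbit`), the core points are
sealed, and a shadow point of a key with shadow data is of the shadow kind
(`shadowKind_of_mem_shadowBlock`); without a dropped arm the shadow points are core points.
-/

namespace Summit.Ventures.PercRepro2

namespace LocRows

open Hull

variable {V : Type*} {E : Type*} [Fintype E] [DecidableEq E]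

open scoped Classical

variable {ends : E → Sym2 V} {U : Set V} {ξ : Config E} {l h o u : V}

omit [Fintype E] [DecidableEq E] in
/-- A core at `u` seals the hull of `u` inside the hull of `h`. -/
lemma hull_u_subset_of_core {ζ : Config E} (hT : u ∈ cluster ends ζ h)
    (hTp : u ∈ cluster ends (blue ζ) h) : hull ends ζ u ⊆ hull ends ζ h := by
  rintro x (hx | hx)
  · exact Or.inl (conn_trans hT hx)
  · exact Or.inr (conn_trans hTp hx)

/-- **An escaping `Q`-point is core-free.** -/
theorem coreFree_of_escaping
    (hout : ∀ x ∈ U, x ≠ h → x ≠ o → x ≠ u →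
      (∃ e y, ends e = s(x, y) ∧ y ∉ U) ∨ (∀ e, x ∉ ends e))
    {ζ : Config E} (hζ : ζ ∈ swOutSide ends l h o U ξ) (hesc : ¬ hull ends ζ u ⊆ U) :
    CoreFree ends ζ h := by
  intro x hxT hxTp
  rcases core_eq_h_or_u hout hζ hxT hxTp with rfl | rfl
  · rfl
  · exfalso
    apply hesc
    exact (hull_u_subset_of_core hxT hxTp).trans (mem_outClass.1 (mem_swOutSide.1 hζ).2).2

/-- The extended hull of a core-kind class point lies in `U`. -/
theorem extHull_subset_of_coreKind {ζ : Config E} (hζ : ζ ∈ swOutSide ends l h o U ξ)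
    (hk : CoreKind ends U h u ζ) : extHull ends ζ h u ⊆ U := by
  rintro x (hx | hx)
  · exact (mem_outClass.1 (mem_swOutSide.1 hζ).2).2 hx
  · exact hk.2 hx

section OneSided

variable {ι : Type*} {A : ι → Set V} {pure : ι → Prop} {b : Config E} {H : Set V}
  (hb : CoreBase ends b h u H A pure)
include hb

omit [Fintype E] [DecidableEq E] in
/-- A core-free core point with `u` in the hull is one-sided. -/
theorem CoreBase.oneSided_of_coreFree {ω : Config ι} (hc : CoreFree ends (coreReal ends A b ω) h)
    (hu : u ∈ hull ends (coreReal ends A b ω) h) :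
    (uRed ends A u pure ω ∧ ¬ uRed ends A u pure (flipAll ω)) ∨
      (¬ uRed ends A u pure ω ∧ uRed ends A u pure (flipAll ω)) := by
  have key : ∀ ω' : Config ι, u ∈ redSet ends A h u pure ω' → uRed ends A u pure ω' := by
    intro ω' hu'
    rw [mem_redSet_iff] at hu'
    rcases hu' with h1 | ⟨i, _, _, hi⟩ | ⟨h1, _⟩
    · exact absurd h1.symm hb.hne
    · exact absurd hi (hb.u_notMem_arm i)
    · exact h1
  have hnot : ¬ (uRed ends A u pure ω ∧ uRed ends A u pure (flipAll ω)) := by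
    rintro ⟨h1, h2⟩
    have hT := hb.u_mem_cluster_of_uRed h1
    have hTp : u ∈ cluster ends (blue (coreReal ends A b ω)) h := by
      rw [hb.blue_coreReal]
      exact hb.dual.u_mem_cluster_of_uRed h2
    exact hb.hne (hc u hT hTp).symm
  rcases hu with hu | hu
  · rw [hb.cluster_coreReal] at hu
    exact Or.inl ⟨key ω hu, fun h2 => hnot ⟨key ω hu, h2⟩⟩
  · rw [hb.cluster_blue_coreReal] at hu
    exact Or.inr ⟨fun h1 => hnot ⟨h1, key _ hu⟩, key _ hu⟩

omit [Fintype E] [DecidableEq E] hb in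
/-- The normalised one-sided point of a one-sided cube point. -/
theorem exists_normalised {ω : Config ι}
    (hone : (uRed ends A u pure ω ∧ ¬ uRed ends A u pure (flipAll ω)) ∨
      (¬ uRed ends A u pure ω ∧ uRed ends A u pure (flipAll ω))) :
    ∃ ω₀ : Config ι, uRed ends A u pure ω₀ ∧ ¬ uRed ends A u pure (flipAll ω₀) ∧
      ((∀ i, uAdjC ends u A i → ω i = ω₀ i) ∨
        (∀ i, uAdjC ends u A i → ω i = toggle (uAdjC ends u A) ω₀ i)) := by
  rcases hone with ⟨h1, h2⟩ | ⟨h1, h2⟩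
  · exact ⟨ω, h1, h2, Or.inl fun _ _ => rfl⟩
  · refine ⟨toggle (uAdjC ends u A) ω, ?_, ?_, Or.inr fun i _ => by rw [toggle_toggle]⟩
    · refine (uRed_congr ?_).2 h2
      intro i hi
      simp only [flipAll, toggle_apply_of_pos hi]
    · intro h3
      apply h1
      refine (uRed_congr ?_).1 h3
      intro i hi
      simp only [flipAll, toggle_apply_of_pos hi, Bool.not_not]

omit [Fintype E] [DecidableEq E] in
/-- The extended hull of the base is `H`. -/
theorem CoreBase.extHull_base : extHull ends b h u = H := by
  have := hb.extHull_coreReal (fun _ => true)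
  rwa [CoreBase.coreReal_top] at this

end OneSided

/-! ## The canonical red set of a one-sided point -/

section RedSet

variable {S : Finset (Set V)} (ω₀ : Config S)

/-- The red set of a one-sided point: the far arms and the red u-adjacent arms. -/
noncomputable def redSetOf (ends : E → Sym2 V) (u : V) : Finset (Set V) :=
  (Finset.univ.filter fun i : S => ¬ uAdjC ends u (armsFun S) i ∨ ω₀ i = true).map
    (Function.Embedding.subtype _)

omit [Fintype E] [DecidableEq E] in
/-- Membership in the red set. -/
lemma mem_redSetOf_iff (i : S) :
    i.1 ∈ redSetOf ω₀ ends u ↔ ¬ uAdjC ends u (armsFun S) i ∨ ω₀ i = true := by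
  simp only [redSetOf]
  rw [show i.1 = (Function.Embedding.subtype fun x => x ∈ S) i from rfl, Finset.mem_map',
    Finset.mem_filter]
  simp

omit [Fintype E] [DecidableEq E] in
/-- `omegaSR` of the red set agrees with `ω₀` on the u-adjacent arms. -/
lemma omegaSR_redSetOf (i : S) (hi : uAdjC ends u (armsFun S) i) :
    ω₀ i = omegaSR S (redSetOf ω₀ ends u) i := by
  simp only [omegaSR]
  cases hω : ω₀ i with
  | true =>
    symm
    rw [decide_eq_true_eq, mem_redSetOf_iff]
    exact Or.inr hω
  | false =>
    symm
    rw [decide_eq_false_iff_not, mem_redSetOf_iff]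
    rintro (h' | h')
    · exact h' hi
    · rw [hω] at h'; exact absurd h' (by decide)

omit [DecidableEq E] in
/-- The red set has the canonical form. -/
lemma redSetOf_canon :
    redSetOf ω₀ ends u =
      S.filter fun P => (∃ e x, ends e = s(u, x) ∧ x ∈ P) → P ∈ redSetOf ω₀ ends u := by
  ext P
  simp only [Finset.mem_filter]
  constructor
  · intro hP
    refine ⟨?_, fun _ => hP⟩
    simp only [redSetOf, Finset.mem_map, Finset.mem_filter, Finset.mem_univ, true_and] at hP
    obtain ⟨i, _, rfl⟩ := hP
    exact i.2
  · rintro ⟨hP, hadj⟩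
    by_cases hu' : ∃ e x, ends e = s(u, x) ∧ x ∈ P
    · exact hadj hu'
    · exact (mem_redSetOf_iff ω₀ ⟨P, hP⟩).2 (Or.inl hu')

end RedSet

/-! ## The two orbit lemmas -/

section Orbits

variable (hl : l ∉ U) (hhu : h ≠ u) (hloop_h : ∀ e, ends e ≠ s(h, h))
  (hloop_u : ∀ e, ends e ≠ s(u, u)) (hnadj : ∀ e, ends e ≠ s(h, u))
  (hout : ∀ x ∈ U, x ≠ h → x ≠ o → x ≠ u →
    (∃ e y, ends e = s(x, y) ∧ y ∉ U) ∨ (∀ e, x ∉ ends e))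
  (hH1 : H1 ends U h u)
include hl hhu hloop_h hloop_u hnadj hout hH1

/-- **The orbit through a sealed point**: an escaping `Q`-point of the coarse orbit of a core-free
core-kind `Q`-point is of the shadow kind. -/
theorem shadowKind_of_mem_orbit_coreKind {ζ' : Config E} (hζ' : ζ' ∈ swOutSide ends l h o U ξ)
    (hk : CoreKind ends U h u ζ') (hc' : CoreFree ends ζ' h) {ζ : Config E}
    (hζ : ζ ∈ orbit ends (allRed ends ζ' h) h) (hQ : ζ ∈ tgtU ends l h {T : Set V | o ∈ T})
    (hesc : ¬ hull ends ζ u ⊆ U) : ShadowKind ends U ξ h u ζ := by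
  have hb : CoreBase ends (coreBaseOf ends ζ' h u) h u (extHull ends ζ' h u)
      (armsFun (armsC ends h u ζ')) (pureFun ends h (armsC ends h u ζ')) :=
    coreBase_of_coreKind hl hhu hloop_h hloop_u hnadj hout hH1 hζ' hk
  have hHU := extHull_subset_of_coreKind hζ' hk
  have hrep : coreReal ends (armsFun (armsC ends h u ζ')) (coreBaseOf ends ζ' h u)
      (omegaOf ends h u ζ') = ζ' := coreReal_coreBaseOf hl hhu hout hζ' hk
  have hone := hb.oneSided_of_coreFree (ω := omegaOf ends h u ζ') (by rw [hrep]; exact hc')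
    (by rw [hrep]; exact hk.1)
  obtain ⟨ω₀, huR, huB, hω⟩ := exists_normalised (A := armsFun (armsC ends h u ζ'))
    (pure := pureFun ends h (armsC ends h u ζ')) hone
  have hconn : ArmsConnected (armsFun (armsC ends h u ζ')) ends := armsConnected_armsC ζ'
  rw [← hrep] at hζ
  rcases hb.mem_orbit_coreReal_oneSided huR huB hconn hω hζ with ⟨ω'', hζeq⟩ | ⟨ω₁, hζeq⟩
  · -- `ζ` is a shadow point of the normalised point
    have hagree : ∀ i, uAdjC ends u (armsFun (armsC ends h u ζ')) i →
        ω₀ i = omegaSR (armsC ends h u ζ') (redSetOf ω₀ ends u) i :=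
      fun i hi => omegaSR_redSetOf ω₀ i hi
    have hb' : CoreBase ends (coreBaseOf ends ζ' h u) h u (extHull ends (coreBaseOf ends ζ' h u) h u)
        (armsFun (armsC ends h u ζ')) (pureFun ends h (armsC ends h u ζ')) := by
      rw [hb.extHull_base]; exact hb
    by_cases hZ : ∃ P : armsC ends h u ζ', uAdjC ends u (armsFun (armsC ends h u ζ')) P ∧ ω₀ P = false
    · have hζblk : ζ ∈ shadowBlock ends u (coreBaseOf ends ζ' h u) (armsC ends h u ζ')
          (redSetOf ω₀ ends u) := by
        rw [mem_shadowBlock_iff]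
        refine ⟨ω'', ?_⟩
        rw [hζeq, sB_congr hagree, sZ_congr hagree, shadowOf_congr hagree]
      have hd : ShadowData ends U ξ h u (coreBaseOf ends ζ' h u) (armsC ends h u ζ')
          (redSetOf ω₀ ends u) :=
        { hS := (armsC_eq_of_extHull_eq (hb.extHull_base)).symm
          hb := hb'
          hHU := by rw [hb.extHull_base]; exact hHU
          hbcl := coreBaseOf_mem_outClass (mem_swOutSide.1 hζ').2 hk hb
          huR := (uRed_congr hagree).1 huR
          huB := fun h' => huB ((uRed_congr (flipAll_congr hagree)).2 h')
          hZ := by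
            obtain ⟨P, hP, hωP⟩ := hZ
            exact ⟨P, hP, by rw [← hagree P hP]; exact hωP⟩
          hR := redSetOf_canon ω₀ }
      exact (shadowKind_of_mem_shadowBlock hl hout hd hζblk hQ).2.2.2.1
    · -- no dropped arm: `ζ` is a core point, not escaping
      exfalso
      have hZ' : ∀ i, uAdjC ends u (armsFun (armsC ends h u ζ')) i → ω₀ i = true := by
        intro i hi
        by_contra hne
        exact hZ ⟨i, hi, by simpa using hne⟩
      obtain ⟨ω₁, hω₁⟩ := hb.shadowReal_eq_coreReal_of_no_drop hZ' ω''
      apply hesc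
      rw [hζeq, hω₁]
      exact (hb.hull_u_coreReal_subset ω₁).trans hHU
  · exfalso
    apply hesc
    rw [hζeq]
    exact (hb.hull_u_coreReal_subset ω₁).trans hHU

omit hhu hloop_h hloop_u hnadj hH1 in
/-- **The orbit through a shadow point**: an escaping `Q`-point of the coarse orbit of a
shadow-kind point is of the shadow kind. -/
theorem shadowKind_of_mem_orbit_shadowKind {ζ' : Config E} (hsk : ShadowKind ends U ξ h u ζ')
    {ζ : Config E} (hζ : ζ ∈ orbit ends (allRed ends ζ' h) h)
    (hQ : ζ ∈ tgtU ends l h {T : Set V | o ∈ T}) (hesc : ¬ hull ends ζ u ⊆ U) :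
    ShadowKind ends U ξ h u ζ := by
  obtain ⟨hd, hblk⟩ := hsk
  have hconn : ArmsConnected (armsFun (armsOf ends h u ζ')) ends := by
    rw [hd.hS]; exact armsConnected_armsC _
  obtain ⟨ω'', hζ'eq⟩ := (mem_shadowBlock_iff).1 hblk
  rw [← hζ'eq] at hζ
  rcases hd.hb.mem_orbit_shadowReal hd.huR hd.huB hconn ω'' hζ with ⟨ω''', hζeq⟩ | ⟨ω₁, hζeq⟩
  · have hζblk : ζ ∈ shadowBlock ends u (baseOf ends h u ζ') (armsOf ends h u ζ')
        (redOf ends h u ζ') := (mem_shadowBlock_iff).2 ⟨ω''', hζeq.symm⟩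
    exact (shadowKind_of_mem_shadowBlock hl hout hd hζblk hQ).2.2.2.1
  · exfalso
    apply hesc
    rw [hζeq]
    exact (hd.hb.hull_u_coreReal_subset ω₁).trans hd.hHU

/-- **A `Q`-point of the orbit of an escaping point of the plain kind is escaping of the plain
kind** (and lies in the class). -/
theorem mem_orbit_plain {ζ : Config E} (hζ : ζ ∈ swOutSide ends l h o U ξ)
    (hu : u ∈ hull ends ζ h) (hesc : ¬ hull ends ζ u ⊆ U) (hns : ¬ ShadowKind ends U ξ h u ζ)
    {ζ' : Config E} (hζ' : ζ' ∈ orbit ends (allRed ends ζ h) h)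
    (hQ : ζ' ∈ tgtU ends l h {T : Set V | o ∈ T}) :
    ζ' ∈ swOutSide ends l h o U ξ ∧ u ∈ hull ends ζ' h ∧ ¬ hull ends ζ' u ⊆ U ∧
      ¬ ShadowKind ends U ξ h u ζ' := by
  have hc : CoreFree ends ζ h := coreFree_of_escaping hout hζ hesc
  have hc₀ : CoreFree ends (allRed ends ζ h) h := coreFree_allRed hc
  have hcl₀ : allRed ends ζ h ∈ outClass ends U h ξ :=
    allRed_mem_outClass (mem_swOutSide.1 hζ).2 hc
  have hmem := hζ'
  simp only [orbit, Finset.mem_image, Finset.mem_univ, true_and] at hmem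
  obtain ⟨ω', rfl⟩ := hmem
  have hζ'cl : orbitReal ends (allRed ends ζ h) h ω' ∈ swOutSide ends l h o U ξ :=
    mem_swOutSide.2 ⟨hQ, orbitReal_mem_outClass hc₀ hcl₀ ω'⟩
  have hu' : u ∈ hull ends (orbitReal ends (allRed ends ζ h) h ω') h := by
    rw [hull_orbitReal hc₀, hull_allRed hc]; exact hu
  have hc' : CoreFree ends (orbitReal ends (allRed ends ζ h) h ω') h := coreFree_orbitReal hc₀ ω'
  have hζorb : ζ ∈ orbit ends (allRed ends (orbitReal ends (allRed ends ζ h) h ω') h) h := by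
    rw [allRed_orbitReal hc₀, allRed_idem hc]
    obtain ⟨ω, hω⟩ := exists_orbitReal_eq (ζ₀ := allRed ends ζ h) hc rfl
    simp only [orbit, Finset.mem_image, Finset.mem_univ, true_and]
    exact ⟨ω, hω⟩
  have hQζ : ζ ∈ tgtU ends l h {T : Set V | o ∈ T} := (mem_swOutSide.1 hζ).1
  refine ⟨hζ'cl, hu', fun hsub => ?_, fun hsk => ?_⟩
  · exact hns (shadowKind_of_mem_orbit_coreKind hl hhu hloop_h hloop_u hnadj hout hH1 hζ'cl
      ⟨hu', hsub⟩ hc' hζorb hQζ hesc)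
  · exact hns (shadowKind_of_mem_orbit_shadowKind hl hout hsk hζorb hQζ hesc)

end Orbits

end LocRows

end Summit.Ventures.PercRepro2
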